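import Summits.Ventures.PercRepro.S1CoreCapAvg
import Summits.Ventures.PercRepro.RankLevelSetCoreCircuitBounds

/-!
# PercRepro — THE AVERAGING RECURSION FOR THE 5-CIRCUITS: `s₅ ≤ 432 / 702 / 1092 / 1638 / 2382 / 3374` at nullity
`7 … 12` (p8 g6, S3)

`proofs/SUBCLAIM-S3-p8.md` §3s. p1's averaging recursion for the 4-circuits (S1CoreCapAvg: the double count over the
points, a non-coloop on at most the average number of circuits, the deletion — a core of nullity one less — and the
non-coloop count `≥ d + 6`) applied WORD FOR WORD to the 5-circuits: `Σ_x #5circ(x) = 5·s₅`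
(`sum_ncard_fiveCircuitsThrough_eq`), some non-coloop `x` lies on at most `⌊5·s₅/m⌋` five-circuits
(`exists_nonColoop_ncard_fiveCircuitsThrough_le`), `s₅(M) ≤ #5circ(x) + s₅(M ＼ {x})`
(`ncard_fiveCircuits_le_through_add_delete`), and on a core of nullity `d + 1 ≥ 7` the non-coloops number at least
`d + 6` (p1's `S1.card_nonColoops_ge`), so **`s₅(d + 1) − ⌊5·s₅(d + 1)/(d + 6)⌋ ≤ s₅(d)`**
(`ncard_fiveCircuits_sub_div_le`). From the crude `s₅ ≤ C(10, 5) = 252` at nullity `6` (night-1's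
`ncard_circuits_le_choose_of_encard`): `s₅ ≤ 432` at nullity `7` (`s − ⌊5s/12⌋ ≤ 252`), `702` at `8`, `1092` at `9`,
`1638` at `10`, `2382` at `11`, `3374` at `12` — against the crude `462 / 792 / 1287 / 2002 / 3003 / 4368`: the
`3–5 %` the cells `(28, 7)` and `(28, 8)` of the `q = 6` window need. Axioms: standard.
-/

open scoped Matroid

namespace PercRepro

namespace ThmN

open Set

variable {α : Type}

open Classical in
/-- **Double count**: over the points of the ground set, the 5-circuits through a point sum to `5 · s₅`. -/
theorem sum_ncard_fiveCircuitsThrough_eq (M : Matroid α) [M.Finite] :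
    ∑ x ∈ M.ground_finite.toFinset, {C : Set α | M.IsCircuit C ∧ C.ncard = 5 ∧ x ∈ C}.ncard =
      5 * {C : Set α | M.IsCircuit C ∧ C.ncard = 5}.ncard := by
  have hS : {C : Set α | M.IsCircuit C ∧ C.ncard = 5}.Finite :=
    M.ground_finite.finite_subsets.subset (fun C hC => hC.1.subset_ground)
  set Sf := hS.toFinset with hSf
  have h1 : ∀ x, {C : Set α | M.IsCircuit C ∧ C.ncard = 5 ∧ x ∈ C}.ncard = (Sf.filter (fun C => x ∈ C)).card := by
    intro x
    rw [← ncard_coe_finset]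
    congr 1
    ext C
    simp only [Finset.coe_filter, hSf, Set.Finite.mem_toFinset, mem_setOf_eq]
    tauto
  have h2 : ∀ C ∈ Sf, (M.ground_finite.toFinset.filter (fun x => x ∈ C)).card = 5 := by
    intro C hC
    rw [hSf, Set.Finite.mem_toFinset] at hC
    have : (M.ground_finite.toFinset.filter (fun x => x ∈ C) : Set α) = C := by
      ext x
      simp only [Finset.coe_filter, Set.Finite.mem_toFinset, mem_setOf_eq]
      exact ⟨fun h => h.2, fun h => ⟨hC.1.subset_ground h, h⟩⟩
    rw [← ncard_coe_finset, this, hC.2]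
  calc ∑ x ∈ M.ground_finite.toFinset, {C : Set α | M.IsCircuit C ∧ C.ncard = 5 ∧ x ∈ C}.ncard
      = ∑ x ∈ M.ground_finite.toFinset, ∑ C ∈ Sf, (if x ∈ C then 1 else 0) := by
        refine Finset.sum_congr rfl (fun x _ => ?_); rw [h1 x, Finset.card_filter]
    _ = ∑ C ∈ Sf, ∑ x ∈ M.ground_finite.toFinset, (if x ∈ C then 1 else 0) := Finset.sum_comm
    _ = ∑ C ∈ Sf, 5 := by
        refine Finset.sum_congr rfl (fun C hC => ?_); rw [← Finset.card_filter, h2 C hC]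
    _ = 5 * {C : Set α | M.IsCircuit C ∧ C.ncard = 5}.ncard := by
        rw [Finset.sum_const, smul_eq_mul, mul_comm, hSf, ← ncard_eq_toFinset_card _ hS]

/-- A coloop lies on no 5-circuit. -/
theorem ncard_fiveCircuitsThrough_eq_zero_of_isColoop (M : Matroid α) {x : α} (hx : M.IsColoop x) :
    {C : Set α | M.IsCircuit C ∧ C.ncard = 5 ∧ x ∈ C}.ncard = 0 := by
  have : {C : Set α | M.IsCircuit C ∧ C.ncard = 5 ∧ x ∈ C} = ∅ := by
    ext C; simp only [mem_setOf_eq, mem_empty_iff_false, iff_false]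
    rintro ⟨hC, _, hxC⟩
    exact hC.not_isColoop_of_mem hxC hx
  rw [this, ncard_empty]

open Classical in
/-- **Averaging**: if `s₅ > 0`, some non-coloop `x` lies on at most `⌊5·s₅ / m⌋` five-circuits, where `m` is the
number of non-coloops. -/
theorem exists_nonColoop_ncard_fiveCircuitsThrough_le (M : Matroid α) [M.Finite]
    (hpos : 0 < {C : Set α | M.IsCircuit C ∧ C.ncard = 5}.ncard) :
    ∃ x ∈ M.E, ¬ M.IsColoop x ∧ {C : Set α | M.IsCircuit C ∧ C.ncard = 5 ∧ x ∈ C}.ncard ≤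
      5 * {C : Set α | M.IsCircuit C ∧ C.ncard = 5}.ncard /
        (M.ground_finite.toFinset.filter (fun x => ¬ M.IsColoop x)).card := by
  have hS : {C : Set α | M.IsCircuit C ∧ C.ncard = 5}.Finite :=
    M.ground_finite.finite_subsets.subset (fun C hC => hC.1.subset_ground)
  have hsum : ∑ x ∈ M.ground_finite.toFinset.filter (fun x => ¬ M.IsColoop x),
      {C : Set α | M.IsCircuit C ∧ C.ncard = 5 ∧ x ∈ C}.ncard = 5 * {C : Set α | M.IsCircuit C ∧ C.ncard = 5}.ncard := by
    rw [Finset.sum_filter_of_ne]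
    · exact sum_ncard_fiveCircuitsThrough_eq M
    · intro x _ hfx hcol
      exact hfx (ncard_fiveCircuitsThrough_eq_zero_of_isColoop M hcol)
  -- the non-coloops are nonempty: a point of a 5-circuit
  have hm : 0 < (M.ground_finite.toFinset.filter (fun x => ¬ M.IsColoop x)).card := by
    obtain ⟨C₀, hC₀⟩ := (ncard_pos hS).1 hpos
    obtain ⟨x₀, hx₀⟩ := hC₀.1.nonempty
    refine Finset.card_pos.2 ⟨x₀, ?_⟩
    rw [Finset.mem_filter, Set.Finite.mem_toFinset]
    exact ⟨hC₀.1.subset_ground hx₀, hC₀.1.not_isColoop_of_mem hx₀⟩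
  by_contra hno
  push Not at hno
  have hall : ∀ x ∈ M.ground_finite.toFinset.filter (fun x => ¬ M.IsColoop x),
      5 * {C : Set α | M.IsCircuit C ∧ C.ncard = 5}.ncard /
        (M.ground_finite.toFinset.filter (fun x => ¬ M.IsColoop x)).card + 1 ≤
        {C : Set α | M.IsCircuit C ∧ C.ncard = 5 ∧ x ∈ C}.ncard := by
    intro x hx
    have hx' := hx
    rw [Finset.mem_filter, Set.Finite.mem_toFinset] at hx'
    have := hno x hx'.1 hx'.2
    omega
  have hge := Finset.card_nsmul_le_sum _ _ _ hall
  rw [smul_eq_mul, hsum] at hge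
  have hdm := Nat.div_add_mod (5 * {C : Set α | M.IsCircuit C ∧ C.ncard = 5}.ncard)
    (M.ground_finite.toFinset.filter (fun x => ¬ M.IsColoop x)).card
  have hmod := Nat.mod_lt (5 * {C : Set α | M.IsCircuit C ∧ C.ncard = 5}.ncard) hm
  have hmul : (M.ground_finite.toFinset.filter (fun x => ¬ M.IsColoop x)).card *
      (5 * {C : Set α | M.IsCircuit C ∧ C.ncard = 5}.ncard /
        (M.ground_finite.toFinset.filter (fun x => ¬ M.IsColoop x)).card + 1) =
      (M.ground_finite.toFinset.filter (fun x => ¬ M.IsColoop x)).card *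
      (5 * {C : Set α | M.IsCircuit C ∧ C.ncard = 5}.ncard /
        (M.ground_finite.toFinset.filter (fun x => ¬ M.IsColoop x)).card) +
      (M.ground_finite.toFinset.filter (fun x => ¬ M.IsColoop x)).card := by ring
  omega

/-- The 5-circuits of `M` are at most those through `e` plus those of `M ＼ {e}` (p1's S1CoreSplit for `5`). -/
theorem ncard_fiveCircuits_le_through_add_delete (M : Matroid α) [M.Finite] (e : α) :
    {C : Set α | M.IsCircuit C ∧ C.ncard = 5}.ncard ≤
      {C : Set α | M.IsCircuit C ∧ C.ncard = 5 ∧ e ∈ C}.ncard +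
        {C : Set α | (M ＼ {e}).IsCircuit C ∧ C.ncard = 5}.ncard := by
  classical
  set S := {C : Set α | M.IsCircuit C ∧ C.ncard = 5} with hS
  set S₁ := {C : Set α | M.IsCircuit C ∧ C.ncard = 5 ∧ e ∈ C} with hS₁
  set S₂ := {C : Set α | (M ＼ {e}).IsCircuit C ∧ C.ncard = 5} with hS₂
  have hS₁fin : S₁.Finite :=
    M.ground_finite.finite_subsets.subset (fun C hC => hC.1.subset_ground)
  have hS₂fin : S₂.Finite :=
    (M ＼ {e}).ground_finite.finite_subsets.subset (fun C hC => hC.1.subset_ground)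
  have hsplit : S ⊆ S₁ ∪ S₂ := by
    intro C hC
    by_cases h : e ∈ C
    · exact Or.inl ⟨hC.1, hC.2, h⟩
    · exact Or.inr ⟨_root_.Matroid.delete_isCircuit_iff.2 ⟨hC.1, disjoint_singleton_right.2 h⟩, hC.2⟩
  calc S.ncard ≤ (S₁ ∪ S₂).ncard := ncard_le_ncard hsplit (hS₁fin.union hS₂fin)
    _ ≤ S₁.ncard + S₂.ncard := ncard_union_le _ _

open Classical in
/-- **The averaging recursion for the 5-circuits**: on a core of nullity `d + 1` with `d ≥ 6`, if every core of
nullity `d` has `s₅ ≤ B`, then `s₅ − ⌊5·s₅/(d + 6)⌋ ≤ B`. -/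
theorem ncard_fiveCircuits_sub_div_le (M : Matroid α) [M.Finite]
    (hfree : ∀ e ∈ M.E, ∃ A ⊆ M.E \ {e}, e ∉ M.closure A ∧ e ∉ M.closure ((M.E \ {e}) \ A))
    {d : ℕ} (hd : M.E.encard = M.eRank + (d + 1)) (hd6 : 6 ≤ d) {B : ℕ}
    (hB : ∀ (M' : Matroid α) [M'.Finite],
      (∀ e ∈ M'.E, ∃ A ⊆ M'.E \ {e}, e ∉ M'.closure A ∧ e ∉ M'.closure ((M'.E \ {e}) \ A)) →
      M'.E.encard = M'.eRank + d → {C : Set α | M'.IsCircuit C ∧ C.ncard = 5}.ncard ≤ B) :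
    {C : Set α | M.IsCircuit C ∧ C.ncard = 5}.ncard -
      5 * {C : Set α | M.IsCircuit C ∧ C.ncard = 5}.ncard / (d + 6) ≤ B := by
  rcases Nat.eq_zero_or_pos {C : Set α | M.IsCircuit C ∧ C.ncard = 5}.ncard with h0 | hpos
  · rw [h0]; simp
  obtain ⟨x, hxE, hxc, hx⟩ := exists_nonColoop_ncard_fiveCircuitsThrough_le M hpos
  -- the non-coloops number at least `d + 6`
  have hm : d + 6 ≤ (M.ground_finite.toFinset.filter (fun x => ¬ M.IsColoop x)).card := by
    have : (M.ground_finite.toFinset.filter (fun x => ¬ M.IsColoop x) : Set α) = M.E \ M.coloops := by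
      ext y; simp only [Finset.coe_filter, Set.Finite.mem_toFinset, mem_setOf_eq, mem_sdiff,
        Matroid.isColoop_iff_mem_coloops]
    rw [← ncard_coe_finset, this]
    exact S1.card_nonColoops_ge M hfree hd hd6
  have hx' : {C : Set α | M.IsCircuit C ∧ C.ncard = 5 ∧ x ∈ C}.ncard ≤
      5 * {C : Set α | M.IsCircuit C ∧ C.ncard = 5}.ncard / (d + 6) :=
    hx.trans (Nat.div_le_div_left hm (by omega))
  -- `M ＼ {x}` is a core of nullity `d`
  have hν : M✶.eRank = ((d + 1 : ℕ) : ℕ∞) := by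
    have h := _root_.Matroid.eRank_add_eRank_dual M
    rw [hd] at h
    exact WithTop.add_left_cancel (PercRepro.Matroid.eRank_ne_top_of_finite M) h
  have hdel := PercRepro.Matroid.dual_eRank_delete_singleton_add_one hxE hxc
  rw [hν] at hdel
  have hfin' : (M ＼ {x})✶.eRank ≠ ⊤ := by
    intro h
    rw [h] at hdel
    have h2 : ((d + 1 : ℕ) : ℕ∞) = ⊤ := by rw [← hdel]; simp
    exact ENat.coe_ne_top _ h2
  obtain ⟨d', hd'⟩ := ENat.ne_top_iff_exists.1 hfin'
  have hdd' : d = d' := by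
    rw [← hd'] at hdel
    have : d' + 1 = d + 1 := by exact_mod_cast hdel
    omega
  subst hdd'
  have hd'enc : (M ＼ {x}).E.encard = (M ＼ {x}).eRank + d := by
    have h := _root_.Matroid.eRank_add_eRank_dual (M ＼ {x})
    rw [← hd'] at h
    exact h.symm
  have hB' := hB (M ＼ {x}) (S1.hfree_delete M hfree x) hd'enc
  have hsplit := ncard_fiveCircuits_le_through_add_delete M x
  omega

/-- **`s₅ ≤ 252` at nullity `6`**: the crude count `C(d + 4, 5)` (night-1). -/
theorem ncard_fiveCircuits_le_two_fifty_two (M : Matroid α) [M.Finite]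
    (hd : M.E.encard = M.eRank + 6) : {C : Set α | M.IsCircuit C ∧ C.ncard = 5}.ncard ≤ 252 := by
  have h := Matroid.ncard_circuits_le_choose_of_encard M (ν := 6) (by exact_mod_cast hd) 4
  exact h.trans (by decide)

/-- **`s₅ ≤ 432` on every core of nullity 7** (`s − ⌊5s/12⌋ ≤ 252 ⟹ s ≤ 432`). -/
theorem ncard_fiveCircuits_le_four_thirty_two (M : Matroid α) [M.Finite]
    (hfree : ∀ e ∈ M.E, ∃ A ⊆ M.E \ {e}, e ∉ M.closure A ∧ e ∉ M.closure ((M.E \ {e}) \ A))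
    (hd : M.E.encard = M.eRank + 7) : {C : Set α | M.IsCircuit C ∧ C.ncard = 5}.ncard ≤ 432 := by
  have h := ncard_fiveCircuits_sub_div_le M hfree (d := 6) hd (le_refl 6)
    (fun M' _ _ hd' => ncard_fiveCircuits_le_two_fifty_two M' hd')
  omega

/-- **`s₅ ≤ 702` on every core of nullity 8** (`s − ⌊5s/13⌋ ≤ 432 ⟹ s ≤ 702`). -/
theorem ncard_fiveCircuits_le_seven_oh_two (M : Matroid α) [M.Finite]
    (hfree : ∀ e ∈ M.E, ∃ A ⊆ M.E \ {e}, e ∉ M.closure A ∧ e ∉ M.closure ((M.E \ {e}) \ A))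
    (hd : M.E.encard = M.eRank + 8) : {C : Set α | M.IsCircuit C ∧ C.ncard = 5}.ncard ≤ 702 := by
  have h := ncard_fiveCircuits_sub_div_le M hfree (d := 7) hd (by norm_num)
    (fun M' _ hfree' hd' => ncard_fiveCircuits_le_four_thirty_two M' hfree' hd')
  omega

/-- **`s₅ ≤ 1092` on every core of nullity 9** (`s − ⌊5s/14⌋ ≤ 702 ⟹ s ≤ 1092`). -/
theorem ncard_fiveCircuits_le_ten_ninety_two (M : Matroid α) [M.Finite]
    (hfree : ∀ e ∈ M.E, ∃ A ⊆ M.E \ {e}, e ∉ M.closure A ∧ e ∉ M.closure ((M.E \ {e}) \ A))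
    (hd : M.E.encard = M.eRank + 9) : {C : Set α | M.IsCircuit C ∧ C.ncard = 5}.ncard ≤ 1092 := by
  have h := ncard_fiveCircuits_sub_div_le M hfree (d := 8) hd (by norm_num)
    (fun M' _ hfree' hd' => ncard_fiveCircuits_le_seven_oh_two M' hfree' hd')
  omega

/-- **`s₅ ≤ 1638` on every core of nullity 10** (`s − ⌊5s/15⌋ ≤ 1092 ⟹ s ≤ 1638`). -/
theorem ncard_fiveCircuits_le_sixteen_thirty_eight (M : Matroid α) [M.Finite]
    (hfree : ∀ e ∈ M.E, ∃ A ⊆ M.E \ {e}, e ∉ M.closure A ∧ e ∉ M.closure ((M.E \ {e}) \ A))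
    (hd : M.E.encard = M.eRank + 10) : {C : Set α | M.IsCircuit C ∧ C.ncard = 5}.ncard ≤ 1638 := by
  have h := ncard_fiveCircuits_sub_div_le M hfree (d := 9) hd (by norm_num)
    (fun M' _ hfree' hd' => ncard_fiveCircuits_le_ten_ninety_two M' hfree' hd')
  omega

/-- **`s₅ ≤ 2382` on every core of nullity 11** (`s − ⌊5s/16⌋ ≤ 1638 ⟹ s ≤ 2382`). -/
theorem ncard_fiveCircuits_le_twenty_three_eighty_two (M : Matroid α) [M.Finite]
    (hfree : ∀ e ∈ M.E, ∃ A ⊆ M.E \ {e}, e ∉ M.closure A ∧ e ∉ M.closure ((M.E \ {e}) \ A))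
    (hd : M.E.encard = M.eRank + 11) : {C : Set α | M.IsCircuit C ∧ C.ncard = 5}.ncard ≤ 2382 := by
  have h := ncard_fiveCircuits_sub_div_le M hfree (d := 10) hd (by norm_num)
    (fun M' _ hfree' hd' => ncard_fiveCircuits_le_sixteen_thirty_eight M' hfree' hd')
  omega

/-- **`s₅ ≤ 3374` on every core of nullity 12** (`s − ⌊5s/17⌋ ≤ 2382 ⟹ s ≤ 3374`). -/
theorem ncard_fiveCircuits_le_thirty_three_seventy_four (M : Matroid α) [M.Finite]
    (hfree : ∀ e ∈ M.E, ∃ A ⊆ M.E \ {e}, e ∉ M.closure A ∧ e ∉ M.closure ((M.E \ {e}) \ A))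
    (hd : M.E.encard = M.eRank + 12) : {C : Set α | M.IsCircuit C ∧ C.ncard = 5}.ncard ≤ 3374 := by
  have h := ncard_fiveCircuits_sub_div_le M hfree (d := 11) hd (by norm_num)
    (fun M' _ hfree' hd' => ncard_fiveCircuits_le_twenty_three_eighty_two M' hfree' hd')
  omega

end ThmN

end PercRepro
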